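import Summits.QuantumFields.BalabanUV.Beta.EriceFlowEnclosureLogPeriodicLaw

/-!
# Beta / EriceFlowEnclosureLogPeriodicLetter — SERVICE FILE (3∕3): THE LAW IN THE SEQUENCE'S OWN SCALE AND IN THE DEPTH, THE LIMIT
# CONSTANT AS A LOG-PERIODIC FUNCTION OF THE START, AND NO 1∕K LETTER.  Continuing P2 #45-B for the almost-unit-step sequence
# `u_{j+1} − u_j = 1 − sin(log u_{j+1})∕u_{j+1}²` (u ≥ 2), `E j = u j − j → c`:
#   **`|E K − c − (sin(log u_K) + cos(log u_K))∕(2u_K)| ≤ 9∕u_K²`**  (every K; `logPeriodic_law'`),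
#   **`|c − (u₀ − (sin(log u₀) + cos(log u₀))∕(2u₀))| ≤ 9∕u₀²`**  (`limit_const_law`: in P2 #45's letters `c(s) = 1∕s − (s∕2)(cos log s − sin log s)
#      + O(s²)` — the Λ-parameter of the toy is log-periodic at order g²),
#   **`|E K − c − (sin(log K) + cos(log K))∕(2K)| ≤ (8 + 2u₀)∕K²`**  (K ≥ 1; `logPeriodic_law_nat`),
#   `K·(E K − c) − (sin(log K) + cos(log K))∕2 → 0` (`scaled_error_tendsto`), hence **`K·(E K − c)` HAS NO LIMIT**
#   (`scaled_error_not_tendsto`, P2 #45-A `sin_log_add_cos_log_not_tendsto`) and **NO pair (c′, b) has `K·(E K − c′ − b∕K) → 0`**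
#   (`no_invK_letter`): the expansion `E K = c′ + b∕K + o(1∕K)` does not exist
# (β-flow team, prover 2 = lower ∕ positivity side, unit `b2b-balaban-beta-bflow-p2`, gen 28; module P2 #45-C over P2 #45-A∕B; consumed by
# P2 #45 `EriceFlowEnclosureTwoLoopLetterWitness`)

HONEST FRAMING (page 1 of everything the β sub-cell writes): discharging `BetaPertH` makes Bałaban's UV stability UNCONDITIONAL — a
real constructive-QFT result; it is NOT the continuum limit and NOT the Clay problem.  HONEST DEPENDENCY (cell reorg 2026-08-19,
verbatim): «continuum YM on T⁴ ⇐ BetaPertH ∧ nine spine estimates (0/9 proved); BetaPertH ⇐ (D1) ∧ (D4) ∧ CAP+tail; G-an2-4 gates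
asym, D1 and NE2/3/4.»  THIS MODULE DISCHARGES NOTHING: [folklore] real analysis of ONE real sequence (no β-function, no lattice, no
interface); consumed by P2 #45, a TOY witness about the hypothesis classes of the cell's theorems.

THE POINT.  `u_i ≥ u_K + (3∕4)(i − K)` sharpens P2 #45-B's window to `|G_N − G_K| ≤ 9∕u_K²` (`defect_window_le'`), so the error of the
log-periodic law is `9∕u_K²` in the sequence's own scale — at K = 0 this is the LIMIT CONSTANT as a function of the start u₀ = 1∕s;
replacing `F(u_K)` by `F(K)` costs `(16∕9K²)·|E K| ≤ 2(u₀ + 1)∕K²` (P2 #45-A `F_lipschitz` on `[3K∕4, ∞[`); the scaled error then differs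
from `(sin log K + cos log K)∕2` by `O(1∕K)`, and that function has no limit.

WHAT THIS FILE PROVES (0 sorry, 0 def): `defect_window_le'`, **`logPeriodic_law'`**, **`limit_const_law`**, **`logPeriodic_law_nat`**,
`scaled_error_tendsto`, **`scaled_error_not_tendsto`**, **`no_invK_letter`**.
NOT CLAIMED: anything about a β-function, (3.62), (3.76), (1.22), `BetaPertH`, continuum, Clay — see P2 #45 for the (toy) β-side reading.
-/

namespace Summit.QuantumFields.BalabanUV.Beta.EriceFlowEnclosureLogPeriodicLetter

open Set Filter Topology
open Summit.QuantumFields.BalabanUV.Beta.EriceFlowEnclosureLogPeriodicSums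
open Summit.QuantumFields.BalabanUV.Beta.EriceFlowEnclosureLogPeriodicLaw

noncomputable section

section Seq

variable {u : ℕ → ℝ}

/-- **The window estimate in the sequence's own scale**: for `K ≤ N`, `|(E_N − F(u_N)) − (E_K − F(u_K))| ≤ 9∕u_K²` — the defects
`5∕u_i³` summed with `u_i ≥ u_K + (3∕4)(i − K) = (3∕4)(i + p)`, `p = (4∕3)u_K − K ≥ 8∕3` (P2 #45-A `sum_Ico_inv_add_cube_le`, `(4∕3)u_K − 1 ≥ (5∕6)u_K`).
[folklore] -/
theorem defect_window_le' (hu2 : ∀ j, 2 ≤ u j)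
    (hstep : ∀ j, u (j + 1) - u j = 1 - Real.sin (Real.log (u (j + 1))) / u (j + 1) ^ 2) {K N : ℕ} (hKN : K ≤ N) :
    |((u N - N) - (Real.sin (Real.log (u N)) + Real.cos (Real.log (u N))) / (2 * u N))
        - ((u K - K) - (Real.sin (Real.log (u K)) + Real.cos (Real.log (u K))) / (2 * u K))|
      ≤ 9 / u K ^ 2 := by
  set G : ℕ → ℝ := fun i => (u i - i) - (Real.sin (Real.log (u i)) + Real.cos (Real.log (u i))) / (2 * u i) with hG
  have hK2 : 2 ≤ u K := hu2 K
  have hKlow : 2 + 3 / 4 * (K : ℝ) ≤ u K := seq_lower hu2 hstep K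
  set p : ℝ := 4 / 3 * u K - K with hp
  have hp1 : 1 < p := by rw [hp]; linarith
  have htel : G N - G K = ∑ i ∈ Finset.Ico K N, (G (i + 1) - G i) := by
    have h1 := Finset.sum_range_add_sum_Ico (fun i => G (i + 1) - G i) hKN
    rw [Finset.sum_range_sub, Finset.sum_range_sub] at h1
    linarith
  have hterm : ∀ i ∈ Finset.Ico K N, |G (i + 1) - G i| ≤ 320 / 27 * (1 / ((i : ℝ) + p) ^ 3) := by
    intro i hi
    have hKi : K ≤ i := (Finset.mem_Ico.mp hi).1
    have h := defect_step_le hu2 hstep i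
    simp only [hG]
    push_cast at h ⊢
    refine h.trans ?_
    have hlow : 3 / 4 * ((i : ℝ) + p) ≤ u i := by
      have := seq_lower_from hu2 hstep hKi
      rw [hp]; linarith
    have hpos : (0 : ℝ) < 3 / 4 * ((i : ℝ) + p) := by
      have : (K : ℝ) ≤ i := by exact_mod_cast hKi
      rw [hp]; linarith
    calc 5 / u i ^ 3 ≤ 5 / (3 / 4 * ((i : ℝ) + p)) ^ 3 :=
          div_le_div_of_nonneg_left (by norm_num) (pow_pos hpos 3) (pow_le_pow_left₀ hpos.le hlow 3)
      _ = 320 / 27 * (1 / ((i : ℝ) + p) ^ 3) := by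
          have hne : (i : ℝ) + p ≠ 0 := by
            have : (K : ℝ) ≤ i := by exact_mod_cast hKi
            rw [hp]; linarith
          field_simp
          ring
  have hsum : ∑ i ∈ Finset.Ico K N, 1 / ((i : ℝ) + p) ^ 3 ≤ (18 / 25) / u K ^ 2 := by
    have h := sum_Ico_inv_add_cube_le hp1 hKN
    have hN0 : (0 : ℝ) ≤ N := N.cast_nonneg
    have hK0 : (0 : ℝ) ≤ K := K.cast_nonneg
    have h1 : 0 ≤ 1 / ((N : ℝ) + p - 1) ^ 2 := by positivity
    have e : (K : ℝ) + p - 1 = 4 / 3 * u K - 1 := by rw [hp]; ring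
    rw [e] at h
    have h56 : 5 / 6 * u K ≤ 4 / 3 * u K - 1 := by linarith
    have h2 : 1 / (4 / 3 * u K - 1) ^ 2 ≤ 1 / (5 / 6 * u K) ^ 2 :=
      one_div_le_one_div_of_le (by positivity) (pow_le_pow_left₀ (by positivity) h56 2)
    have e2 : 1 / (5 / 6 * u K) ^ 2 / 2 = (18 / 25) / u K ^ 2 := by
      field_simp; ring
    linarith
  have hGoal : |G N - G K| ≤ 9 / u K ^ 2 := by
    calc |G N - G K| = |∑ i ∈ Finset.Ico K N, (G (i + 1) - G i)| := by rw [htel]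
      _ ≤ ∑ i ∈ Finset.Ico K N, |G (i + 1) - G i| := Finset.abs_sum_le_sum_abs _ _
      _ ≤ ∑ i ∈ Finset.Ico K N, 320 / 27 * (1 / ((i : ℝ) + p) ^ 3) := Finset.sum_le_sum hterm
      _ = 320 / 27 * ∑ i ∈ Finset.Ico K N, 1 / ((i : ℝ) + p) ^ 3 := by rw [Finset.mul_sum]
      _ ≤ 320 / 27 * ((18 / 25) / u K ^ 2) := by gcongr
      _ = (256 / 30) * (1 / u K ^ 2) := by ring
      _ ≤ 9 * (1 / u K ^ 2) := mul_le_mul_of_nonneg_right (by norm_num) (by positivity)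
      _ = 9 / u K ^ 2 := by ring
  simpa only [hG] using hGoal

/-- **THE LOG-PERIODIC LAW IN THE SEQUENCE'S OWN SCALE**: with the c of `logPeriodic_law`,
**`|E K − c − (sin(log u_K) + cos(log u_K))∕(2u_K)| ≤ 9∕u_K²` for every K** (window `defect_window_le'`, N → ∞). [folklore] -/
theorem logPeriodic_law' (hu2 : ∀ j, 2 ≤ u j)
    (hstep : ∀ j, u (j + 1) - u j = 1 - Real.sin (Real.log (u (j + 1))) / u (j + 1) ^ 2)
    {c : ℝ} (hc : Tendsto (fun K : ℕ => u K - K) atTop (𝓝 c)) (K : ℕ) :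
    |(u K - K) - c - (Real.sin (Real.log (u K)) + Real.cos (Real.log (u K))) / (2 * u K)| ≤ 9 / u K ^ 2 := by
  set G : ℕ → ℝ := fun i => (u i - i) - (Real.sin (Real.log (u i)) + Real.cos (Real.log (u i))) / (2 * u i) with hG
  have hwin : ∀ N : ℕ, K ≤ N → |G N - G K| ≤ 9 / u K ^ 2 := fun N hKN => by
    simpa only [hG] using defect_window_le' hu2 hstep hKN
  -- F(u N) → 0, so G → c
  have hF0 : Tendsto (fun N : ℕ => (Real.sin (Real.log (u N)) + Real.cos (Real.log (u N))) / (2 * u N)) atTop (𝓝 0) := by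
    have hmaj : Tendsto (fun N : ℕ => 1 / (2 + 3 / 4 * (N : ℝ))) atTop (𝓝 0) := by
      have h1 : Tendsto (fun N : ℕ => 2 + 3 / 4 * (N : ℝ)) atTop atTop :=
        tendsto_atTop_add_const_left _ _ (Tendsto.const_mul_atTop (by norm_num) tendsto_natCast_atTop_atTop)
      refine h1.inv_tendsto_atTop.congr fun N => ?_
      simp only [Pi.inv_apply, one_div]
    refine squeeze_zero_norm (fun N => ?_) hmaj
    have hN0 : 0 < u N := by linarith [hu2 N]
    rw [Real.norm_eq_abs]
    exact (abs_F_le hN0).trans (one_div_le_one_div_of_le (by positivity) (seq_lower hu2 hstep N))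
  have hGc : Tendsto G atTop (𝓝 c) := by
    have h := hc.sub hF0
    rw [sub_zero] at h
    exact h
  have hlim : Tendsto (fun N => |G N - G K|) atTop (𝓝 |c - G K|) :=
    (continuous_abs.tendsto _).comp (hGc.sub_const (G K))
  have hbd : ∀ᶠ N in atTop, |G N - G K| ≤ 9 / u K ^ 2 := by
    filter_upwards [Filter.eventually_ge_atTop K] with N hN using hwin N hN
  have h := le_of_tendsto hlim hbd
  rw [abs_sub_comm] at h
  have e : (u K - K) - c - (Real.sin (Real.log (u K)) + Real.cos (Real.log (u K))) / (2 * u K) = G K - c := by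
    simp only [hG]; ring
  rw [e]
  exact h

/-- **THE LIMIT CONSTANT AS A FUNCTION OF THE START**: `|c − (u₀ − (sin(log u₀) + cos(log u₀))∕(2u₀))| ≤ 9∕u₀²` (K = 0 in
`logPeriodic_law'`) — in P2 #45's letters `c(s) = 1∕s − (s∕2)·(cos(log s) − sin(log s)) + O(s²)`: the Λ-parameter of the toy carries a
LOG-PERIODIC term at order s = g². [folklore] -/
theorem limit_const_law (hu2 : ∀ j, 2 ≤ u j)
    (hstep : ∀ j, u (j + 1) - u j = 1 - Real.sin (Real.log (u (j + 1))) / u (j + 1) ^ 2)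
    {c : ℝ} (hc : Tendsto (fun K : ℕ => u K - K) atTop (𝓝 c)) :
    |c - (u 0 - (Real.sin (Real.log (u 0)) + Real.cos (Real.log (u 0))) / (2 * u 0))| ≤ 9 / u 0 ^ 2 := by
  have h := logPeriodic_law' hu2 hstep hc 0
  rw [abs_sub_comm]
  have e : u 0 - (Real.sin (Real.log (u 0)) + Real.cos (Real.log (u 0))) / (2 * u 0) - c
      = (u 0 - ((0 : ℕ) : ℝ)) - c - (Real.sin (Real.log (u 0)) + Real.cos (Real.log (u 0))) / (2 * u 0) := by
    push_cast; ring
  rw [e]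
  exact h

/-- **THE LOG-PERIODIC LAW IN THE DEPTH K**: with the c of `logPeriodic_law`, for every `K ≥ 1`,
**`|E K − c − (sin(log K) + cos(log K))∕(2K)| ≤ (8 + 2u₀)∕K²`** (`|F(u_K) − F(K)| ≤ (16∕9K²)·|E K|` by the Lipschitz bound on `[3K∕4, ∞[`,
`|E K| ≤ u₀ + 2∕3`). [folklore] -/
theorem logPeriodic_law_nat (hu2 : ∀ j, 2 ≤ u j)
    (hstep : ∀ j, u (j + 1) - u j = 1 - Real.sin (Real.log (u (j + 1))) / u (j + 1) ^ 2)
    {c : ℝ} (hc : Tendsto (fun K : ℕ => u K - K) atTop (𝓝 c)) :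
    ∀ K : ℕ, 1 ≤ K → |(u K - K) - c - (Real.sin (Real.log K) + Real.cos (Real.log K)) / (2 * K)|
        ≤ (8 + 2 * u 0) / (K : ℝ) ^ 2 := by
  obtain ⟨c', hc', hlaw⟩ := logPeriodic_law hu2 hstep
  have hcc : c = c' := tendsto_nhds_unique hc hc'
  subst hcc
  intro K hK
  have hK0 : (0 : ℝ) < K := by exact_mod_cast hK
  have hK1 : (1 : ℝ) ≤ K := by exact_mod_cast hK
  have hu0 : 2 ≤ u 0 := hu2 0
  -- both u K and K lie in [3K∕4, ∞[
  have ha : (0 : ℝ) < 3 / 4 * K := by positivity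
  have huK : 3 / 4 * (K : ℝ) ≤ u K := by linarith [seq_lower hu2 hstep K]
  have hKK : 3 / 4 * (K : ℝ) ≤ K := by linarith
  have hLip := F_lipschitz ha huK hKK
  have hEK : |u K - K| ≤ u 0 + 2 / 3 := by
    have h := E_sub_E0_le hu2 hstep K
    have := abs_sub_abs_le_abs_sub (u K - K) (u 0)
    rw [abs_of_pos (by linarith : 0 < u 0)] at this
    linarith
  have h1 : |(Real.sin (Real.log (u K)) + Real.cos (Real.log (u K))) / (2 * u K)
      - (Real.sin (Real.log K) + Real.cos (Real.log K)) / (2 * K)| ≤ 2 * (u 0 + 1) / (K : ℝ) ^ 2 := by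
    refine hLip.trans ?_
    rw [show 1 / (3 / 4 * (K : ℝ)) ^ 2 * |u K - K| = (16 / 9 * |u K - K|) / (K : ℝ) ^ 2 by field_simp; ring]
    exact div_le_div_of_nonneg_right (by linarith) (by positivity)
  have h2 : 6 / ((K : ℝ) + 1) ^ 2 ≤ 6 / (K : ℝ) ^ 2 :=
    div_le_div_of_nonneg_left (by norm_num) (by positivity) (pow_le_pow_left₀ hK0.le (by linarith) 2)
  have h3 := hlaw K
  have e : (8 + 2 * u 0) / (K : ℝ) ^ 2 = 6 / (K : ℝ) ^ 2 + 2 * (u 0 + 1) / (K : ℝ) ^ 2 := by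
    field_simp; ring
  rw [e]
  calc |u K - K - c - (Real.sin (Real.log K) + Real.cos (Real.log K)) / (2 * K)|
      = |(u K - K - c - (Real.sin (Real.log (u K)) + Real.cos (Real.log (u K))) / (2 * u K))
          + ((Real.sin (Real.log (u K)) + Real.cos (Real.log (u K))) / (2 * u K)
              - (Real.sin (Real.log K) + Real.cos (Real.log K)) / (2 * K))| := by ring_nf
    _ ≤ |u K - K - c - (Real.sin (Real.log (u K)) + Real.cos (Real.log (u K))) / (2 * u K)|
          + |(Real.sin (Real.log (u K)) + Real.cos (Real.log (u K))) / (2 * u K)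
              - (Real.sin (Real.log K) + Real.cos (Real.log K)) / (2 * K)| := abs_add_le _ _
    _ ≤ 6 / (K : ℝ) ^ 2 + 2 * (u 0 + 1) / (K : ℝ) ^ 2 := add_le_add (h3.trans h2) h1

/-- **The scaled error IS the log-periodic function**: `K·(E K − c) − (sin(log K) + cos(log K))∕2 → 0`. [folklore] -/
theorem scaled_error_tendsto (hu2 : ∀ j, 2 ≤ u j)
    (hstep : ∀ j, u (j + 1) - u j = 1 - Real.sin (Real.log (u (j + 1))) / u (j + 1) ^ 2)
    {c : ℝ} (hc : Tendsto (fun K : ℕ => u K - K) atTop (𝓝 c)) :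
    Tendsto (fun K : ℕ => (K : ℝ) * ((u K - K) - c) - (Real.sin (Real.log K) + Real.cos (Real.log K)) / 2) atTop (𝓝 0) := by
  have hlaw := logPeriodic_law_nat hu2 hstep hc
  have hmaj : Tendsto (fun K : ℕ => (8 + 2 * u 0) * (1 / (K : ℝ))) atTop (𝓝 ((8 + 2 * u 0) * 0)) :=
    tendsto_one_div_atTop_nhds_zero_nat.const_mul _
  rw [mul_zero] at hmaj
  refine squeeze_zero_norm' ?_ hmaj
  filter_upwards [Filter.eventually_ge_atTop 1] with K hK
  have hK0 : (0 : ℝ) < K := by exact_mod_cast hK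
  have h := hlaw K hK
  rw [Real.norm_eq_abs]
  have e : (K : ℝ) * ((u K - K) - c) - (Real.sin (Real.log K) + Real.cos (Real.log K)) / 2
      = (K : ℝ) * ((u K - K) - c - (Real.sin (Real.log K) + Real.cos (Real.log K)) / (2 * K)) := by
    field_simp
  rw [e, abs_mul, abs_of_pos hK0]
  calc (K : ℝ) * |u K - K - c - (Real.sin (Real.log K) + Real.cos (Real.log K)) / (2 * K)|
      ≤ (K : ℝ) * ((8 + 2 * u 0) / (K : ℝ) ^ 2) := mul_le_mul_of_nonneg_left h hK0.le
    _ = (8 + 2 * u 0) * (1 / (K : ℝ)) := by field_simp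

end Seq

/-! ## §4 No 1∕K letter -/

section NoLetter

variable {u : ℕ → ℝ}

/-- **`K·(E K − c)` HAS NO LIMIT**: along the sequence of §2 the scaled error `K·(E K − c)` differs from the log-periodic
`(sin(log K) + cos(log K))∕2` by o(1), and the latter has no limit. [folklore] -/
theorem scaled_error_not_tendsto (hu2 : ∀ j, 2 ≤ u j)
    (hstep : ∀ j, u (j + 1) - u j = 1 - Real.sin (Real.log (u (j + 1))) / u (j + 1) ^ 2)
    {c : ℝ} (hc : Tendsto (fun K : ℕ => u K - K) atTop (𝓝 c)) (b : ℝ) :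
    ¬ Tendsto (fun K : ℕ => (K : ℝ) * ((u K - K) - c)) atTop (𝓝 b) := by
  intro h
  have h0 := scaled_error_tendsto hu2 hstep hc
  -- (sin log K + cos log K)∕2 = K(E K − c) − (K(E K − c) − (…)∕2) → b − 0
  have h1 := (h.sub h0).const_mul 2
  rw [sub_zero] at h1
  refine sin_log_add_cos_log_not_tendsto (2 * b) (h1.congr fun K => ?_)
  ring

/-- **NO 1∕K LETTER (HEADLINE of §4)**: for NO pair (c′, b) does `K·(E K − c′ − b∕K) → 0` hold — the expansion `E K = c′ + b∕K + o(1∕K)`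
does not exist along the sequence of §2 (first `c′` must be the limit c, then `K·(E K − c) → b` is excluded). [folklore] -/
theorem no_invK_letter (hu2 : ∀ j, 2 ≤ u j)
    (hstep : ∀ j, u (j + 1) - u j = 1 - Real.sin (Real.log (u (j + 1))) / u (j + 1) ^ 2) (c' b : ℝ) :
    ¬ Tendsto (fun K : ℕ => (K : ℝ) * ((u K - K) - c' - b * (1 / K))) atTop (𝓝 0) := by
  intro h
  obtain ⟨c, hc, -⟩ := logPeriodic_law hu2 hstep
  -- c′ = c: E K − c′ − b∕K = (1∕K)·(K·(…)) → 0 and b∕K → 0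
  have hK0 : Tendsto (fun K : ℕ => (1 : ℝ) / K) atTop (𝓝 0) := tendsto_one_div_atTop_nhds_zero_nat
  have h1 : Tendsto (fun K : ℕ => (u K - K) - c' - b * (1 / K)) atTop (𝓝 0) := by
    have h2 : Tendsto (fun K : ℕ => (1 : ℝ) / K * ((K : ℝ) * ((u K - K) - c' - b * (1 / K)))) atTop (𝓝 (0 * 0)) :=
      hK0.mul h
    rw [mul_zero] at h2
    refine h2.congr' ?_
    filter_upwards [Filter.eventually_ge_atTop 1] with K hK
    have hKne : (K : ℝ) ≠ 0 := by positivity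
    field_simp
  have h3 : Tendsto (fun K : ℕ => u K - K) atTop (𝓝 (0 + c' + b * 0)) := by
    have := (h1.add_const c').add (hK0.const_mul b)
    refine this.congr fun K => ?_
    ring
  rw [mul_zero, add_zero, zero_add] at h3
  have hcc : c' = c := tendsto_nhds_unique h3 hc
  rw [hcc] at h
  -- now K·(E K − c) → b, excluded
  refine scaled_error_not_tendsto hu2 hstep hc b ?_
  have h4 : Tendsto (fun K : ℕ => (K : ℝ) * ((u K - K) - c - b * (1 / K)) + b) atTop (𝓝 (0 + b)) := h.add_const b
  rw [zero_add] at h4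
  refine h4.congr' ?_
  filter_upwards [Filter.eventually_ge_atTop 1] with K hK
  have hKne : (K : ℝ) ≠ 0 := by positivity
  field_simp
  ring

end NoLetter

end

end Summit.QuantumFields.BalabanUV.Beta.EriceFlowEnclosureLogPeriodicLetter
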